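import Summits.ValiantsHypothesis.ValiantsHypothesis.Theorems.KPlusLogSqLawTropicalStaticMountainBasics

/-!
# Route «KPlusLogSqLaw» — the static family MOUNTAIN, part 2: cost, degree and counts

HONEST FRAMING.  Helper chain of the object-search cell `pub-symmetroid` (seat val-sym-lift-p1 g5, 2026-08-27) toward
the cruxes `WeakLifting` (ledger item `stmt-ValiantsHypothesis-19561`) / `TropicalB` (`stmt-ValiantsHypothesis-19771`) of
route `KPlusLogSqLaw`, in the vocabulary of `…CensusTropicalKLaw` / `…CensusTropicalKLawStatic` (`TropRootLawAt`,
`TropRootLawAtStatic`, `IsStatic`, `IsDominant`, `termSign`, `tropWeight`).  It is a statement of FINITE TROPICAL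
COMBINATORICS (an explicit dominance design per format `(m, 3)` and its chain); nothing here asserts or bears on `TropicalB`,
`WeakLifting`, `Lifting`, `KPlusLogSqLaw`, the cell's real census or registers (DoorA26 / DoorA34), `MatrixDescartes`
(`stmt-ValiantsHypothesis-18050`) or `VP ≠ VNP`.

Proved here (sorry-free): the mountain `M_(y,z)` costs `W(y,z) = 2Q^z − Q − 1 + Q^z C(y,2)` (`cost_mtn`), has degree
`y + (m+2) z` (`deg_mtn`), `z` anti-excedances (`aexc_mtn`) and `y` excedances (`exc_mtn`); for every permutation:
`deg = exc + (m+2)·aexc` (`deg_eq`), the COST DECOMPOSITION `cost = c0 + ∑ over anti-excedance columns of val` (`cost_eq`;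
unit ascents and the diagonal are free), «no anti-excedance ⟹ identity» (`eq_one_of_aexc_eq_zero`) and `exc + aexc ≤ m`.
-/

-- `Summit.ValiantsHypothesis.ValiantsHypothesis.…` repeats a component by the D-0017 layout
-- (single-conjunct summit), which the `dupNamespace` linter flags; the name is mandated.
set_option linter.dupNamespace false
set_option autoImplicit false

namespace Summit.ValiantsHypothesis.ValiantsHypothesis.Theorems.LacunarySymmetroidMatrixDescartes.TropicalCensus

open Summit.ValiantsHypothesis.ValiantsHypothesis.Theorems.MatrixDescartes.Negative
open scoped BigOperators
open Finset

namespace Mountain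

variable (n : ℕ)

/-- per-column cost of the mountain. -/
theorem val_mtn {y z : ℕ} (h : 1 ≤ y ∧ 1 ≤ z ∧ y + z ≤ n + 1) (i : Fin (n + 1)) :
    val n (mtn n y z i) i = gcost n y z i := by
  have hv := mtn_val n h i
  unfold gcost
  by_cases h0 : (i : ℕ) = 0
  · rw [if_pos h0]
    have : ((mtn n y z i : Fin (n + 1)) : ℕ) = z := by rw [hv, h0, mf_at0]
    rw [val_col0 n _ _ (by omega) h0, this]
  rw [if_neg h0]
  by_cases h1 : (i : ℕ) < z
  · rw [if_pos h1]
    have : ((mtn n y z i : Fin (n + 1)) : ℕ) = i - 1 := by rw [hv, mf_desc y z i (by omega) h1]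
    rw [val_upper n _ _ (by omega), this]
    have e : (i : ℕ) - ((i : ℕ) - 1) = 1 := by omega
    rw [e]; simp
  rw [if_neg h1]
  by_cases h2 : (i : ℕ) + 1 < z + y
  · rw [if_pos h2]
    have : ((mtn n y z i : Fin (n + 1)) : ℕ) = i + 1 := by rw [hv, mf_asc y z i (by omega) h2 h.2.1]
    rw [val_lower n _ _ (by omega) h0]
  rw [if_neg h2]
  by_cases h3 : (i : ℕ) + 1 = z + y
  · rw [if_pos h3]
    have : ((mtn n y z i : Fin (n + 1)) : ℕ) = z - 1 := by rw [hv, mf_top y z i h3 h.2.1 h.1]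
    rw [val_upper n _ _ (by omega), this]
    have e : (i : ℕ) - (z - 1) = y := by omega
    have e2 : z - 1 + 1 = z := by omega
    rw [e, e2]
  · rw [if_neg h3]
    have : ((mtn n y z i : Fin (n + 1)) : ℕ) = i := by rw [hv, mf_fix y z i (by omega) h.2.1]
    have : mtn n y z i = i := Fin.ext this
    rw [this, val_diag]

/-- **the cost of the mountain is `W(y,z)`.** -/
theorem cost_mtn {y z : ℕ} (h : 1 ≤ y ∧ 1 ≤ z ∧ y + z ≤ n + 1) : cost n (mtn n y z) = Wv n y z := by
  unfold cost
  rw [Finset.sum_congr rfl (fun i _ => val_mtn n h i)]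
  rw [Fin.sum_univ_eq_sum_range (gcost n y z) (n + 1), sum_split5 n _ y z h]
  have p0 : gcost n y z 0 = Q n ^ z - Q n := by unfold gcost; rw [if_pos rfl]
  have p1 : ∑ i ∈ Ico 1 z, gcost n y z i = Q n ^ (z - 1) - 1 := by
    rw [Finset.sum_Ico_eq_sum_range]
    rw [Finset.sum_congr rfl (fun k hk => (by
      have hk' := Finset.mem_range.mp hk
      unfold gcost
      rw [if_neg (by omega), if_pos (by omega), show 1 + k - 1 = k by omega]
      : gcost n y z (1 + k) = Q n ^ k * (Q n - 1)))]
    exact geom n (z - 1)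
  have p2 : ∑ i ∈ Ico z (z + y - 1), gcost n y z i = 0 := by
    refine Finset.sum_eq_zero fun i hi => ?_
    have hi' := Finset.mem_Ico.mp hi
    unfold gcost
    rw [if_neg (by omega), if_neg (by omega), if_pos (by omega)]
  have p3 : gcost n y z (z + y - 1) = Q n ^ (z - 1) * (Q n - 1) + Q n ^ z * ((y.choose 2 : ℕ) : ℤ) := by
    unfold gcost
    rw [if_neg (by omega), if_neg (by omega), if_neg (by omega), if_pos (by omega)]
  have p4 : ∑ i ∈ Ico (z + y) (n + 1), gcost n y z i = 0 := by
    refine Finset.sum_eq_zero fun i hi => ?_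
    have hi' := Finset.mem_Ico.mp hi
    unfold gcost
    rw [if_neg (by omega), if_neg (by omega), if_neg (by omega), if_neg (by omega)]
  rw [p0, p1, p2, p3, p4]
  unfold Wv
  rw [if_neg (by omega)]
  obtain ⟨z', rfl⟩ : ∃ z', z = z' + 1 := ⟨z - 1, by omega⟩
  rw [show z' + 1 - 1 = z' by omega, pow_succ]
  ring

/-- per-column degree of the mountain. -/
theorem dd_cls_mtn {y z : ℕ} (h : 1 ≤ y ∧ 1 ≤ z ∧ y + z ≤ n + 1) (i : Fin (n + 1)) :
    (dd n (cls n (mtn n y z i) i) : ℤ) = gdeg n y z i := by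
  have hv := mtn_val n h i
  unfold gdeg
  by_cases h0 : (i : ℕ) = 0
  · rw [if_pos h0]
    rw [cls_lower n _ _ (by rw [hv, h0, mf_at0]; omega), (dd_vals n).2.1]; simp
  rw [if_neg h0]
  by_cases h1 : (i : ℕ) < z
  · rw [if_pos h1, cls_upper n _ _ (by rw [hv, mf_desc y z i (by omega) h1]; omega), (dd_vals n).2.2]; push_cast; ring
  rw [if_neg h1]
  by_cases h2 : (i : ℕ) + 1 < z + y
  · rw [if_pos h2, cls_lower n _ _ (by rw [hv, mf_asc y z i (by omega) h2 h.2.1]; omega), (dd_vals n).2.1]; simp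
  rw [if_neg h2]
  by_cases h3 : (i : ℕ) + 1 = z + y
  · rw [if_pos h3, cls_upper n _ _ (by rw [hv, mf_top y z i h3 h.2.1 h.1]; omega), (dd_vals n).2.2]; push_cast; ring
  · rw [if_neg h3]
    have : ((mtn n y z i : Fin (n + 1)) : ℕ) = i := by rw [hv, mf_fix y z i (by omega) h.2.1]
    have : mtn n y z i = i := Fin.ext this
    rw [this, cls_diag, (dd_vals n).1]; simp

/-- **the degree of the mountain is `y + (m+2) z`.** -/
theorem deg_mtn {y z : ℕ} (h : 1 ≤ y ∧ 1 ≤ z ∧ y + z ≤ n + 1) : deg n (mtn n y z) = Dg n y z := by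
  unfold deg
  rw [Finset.sum_congr rfl (fun i _ => dd_cls_mtn n h i)]
  rw [Fin.sum_univ_eq_sum_range (gdeg n y z) (n + 1), sum_split5 n _ y z h]
  have p0 : gdeg n y z 0 = 1 := by unfold gdeg; rw [if_pos rfl]
  have p1 : ∑ i ∈ Ico 1 z, gdeg n y z i = ((z : ℤ) - 1) * ((n : ℤ) + 3) := by
    rw [Finset.sum_congr rfl (fun i hi => (by
      have hi' := Finset.mem_Ico.mp hi
      unfold gdeg
      rw [if_neg (by omega), if_pos hi'.2]
      : gdeg n y z i = (n : ℤ) + 3))]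
    rw [Finset.sum_const, Nat.card_Ico, nsmul_eq_mul]
    have : ((z - 1 : ℕ) : ℤ) = (z : ℤ) - 1 := by omega
    rw [this]
  have p2 : ∑ i ∈ Ico z (z + y - 1), gdeg n y z i = (y : ℤ) - 1 := by
    rw [Finset.sum_congr rfl (fun i hi => (by
      have hi' := Finset.mem_Ico.mp hi
      unfold gdeg
      rw [if_neg (by omega), if_neg (by omega), if_pos (by omega)]
      : gdeg n y z i = 1))]
    rw [Finset.sum_const, Nat.card_Ico, nsmul_eq_mul, mul_one]
    omega
  have p3 : gdeg n y z (z + y - 1) = (n : ℤ) + 3 := by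
    unfold gdeg
    rw [if_neg (by omega), if_neg (by omega), if_neg (by omega), if_pos (by omega)]
  have p4 : ∑ i ∈ Ico (z + y) (n + 1), gdeg n y z i = 0 := by
    refine Finset.sum_eq_zero fun i hi => ?_
    have hi' := Finset.mem_Ico.mp hi
    unfold gdeg
    rw [if_neg (by omega), if_neg (by omega), if_neg (by omega), if_neg (by omega)]
  rw [p0, p1, p2, p3, p4]
  unfold Dg
  ring

/-- per-column anti-excedance indicator of the mountain. -/
theorem aexc_indicator_mtn {y z : ℕ} (h : 1 ≤ y ∧ 1 ≤ z ∧ y + z ≤ n + 1) (i : Fin (n + 1)) :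
    (if ((mtn n y z i : Fin (n + 1)) : ℕ) < (i : ℕ) then 1 else 0) = gaexc y z i := by
  have hv := mtn_val n h i
  unfold gaexc
  by_cases h0 : (i : ℕ) = 0
  · rw [if_pos h0, if_neg (by rw [hv, h0, mf_at0]; omega)]
  rw [if_neg h0]
  by_cases h1 : (i : ℕ) < z
  · rw [if_pos h1, if_pos (by rw [hv, mf_desc y z i (by omega) h1]; omega)]
  rw [if_neg h1]
  by_cases h2 : (i : ℕ) + 1 < z + y
  · rw [if_pos h2, if_neg (by rw [hv, mf_asc y z i (by omega) h2 h.2.1]; omega)]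
  rw [if_neg h2]
  by_cases h3 : (i : ℕ) + 1 = z + y
  · rw [if_pos h3, if_pos (by rw [hv, mf_top y z i h3 h.2.1 h.1]; omega)]
  · rw [if_neg h3, if_neg (by rw [hv, mf_fix y z i (by omega) h.2.1]; omega)]

/-- **the mountain has `z` anti-excedances.** -/
theorem aexc_mtn {y z : ℕ} (h : 1 ≤ y ∧ 1 ≤ z ∧ y + z ≤ n + 1) : aexc n (mtn n y z) = z := by
  unfold aexc
  rw [Finset.card_filter]
  rw [Finset.sum_congr rfl (fun i _ => aexc_indicator_mtn n h i)]
  rw [Fin.sum_univ_eq_sum_range (gaexc y z) (n + 1), sum_split5 n _ y z h]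
  have p0 : gaexc y z 0 = 0 := by unfold gaexc; rw [if_pos rfl]
  have p1 : ∑ i ∈ Ico 1 z, gaexc y z i = z - 1 := by
    rw [Finset.sum_congr rfl (fun i hi => (by
      have hi' := Finset.mem_Ico.mp hi
      unfold gaexc
      rw [if_neg (by omega), if_pos hi'.2]
      : gaexc y z i = 1))]
    rw [Finset.sum_const, Nat.card_Ico, smul_eq_mul, mul_one]
  have p2 : ∑ i ∈ Ico z (z + y - 1), gaexc y z i = 0 := by
    refine Finset.sum_eq_zero fun i hi => ?_
    have hi' := Finset.mem_Ico.mp hi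
    unfold gaexc
    rw [if_neg (by omega), if_neg (by omega), if_pos (by omega)]
  have p3 : gaexc y z (z + y - 1) = 1 := by
    unfold gaexc
    rw [if_neg (by omega), if_neg (by omega), if_neg (by omega), if_pos (by omega)]
  have p4 : ∑ i ∈ Ico (z + y) (n + 1), gaexc y z i = 0 := by
    refine Finset.sum_eq_zero fun i hi => ?_
    have hi' := Finset.mem_Ico.mp hi
    unfold gaexc
    rw [if_neg (by omega), if_neg (by omega), if_neg (by omega), if_neg (by omega)]
  rw [p0, p1, p2, p3, p4]
  omega

/-- degree = (#excedances) + (m+2)·(#anti-excedances). -/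
theorem deg_eq (σ : Equiv.Perm (Fin (n + 1))) :
    deg n σ = (exc n σ : ℤ) + ((n : ℤ) + 3) * (aexc n σ : ℤ) := by
  unfold deg exc aexc
  have hpt : ∀ i : Fin (n + 1), (dd n (cls n (σ i) i) : ℤ) =
      (if (i : ℕ) < ((σ i : Fin (n + 1)) : ℕ) then (1 : ℤ) else 0) +
        ((n : ℤ) + 3) * (if ((σ i : Fin (n + 1)) : ℕ) < (i : ℕ) then (1 : ℤ) else 0) := by
    intro i
    rcases lt_trichotomy (i : ℕ) ((σ i : Fin (n + 1)) : ℕ) with h | h | h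
    · rw [cls_lower n _ _ h, (dd_vals n).2.1, if_pos h, if_neg (by omega)]; simp
    · have hs : σ i = i := Fin.ext h.symm
      rw [hs, cls_diag, (dd_vals n).1]; simp
    · rw [cls_upper n _ _ h, (dd_vals n).2.2, if_neg (by omega), if_pos h]; push_cast; ring
  rw [Finset.sum_congr rfl (fun i _ => hpt i), Finset.sum_add_distrib, ← Finset.mul_sum, Finset.sum_boole,
    Finset.sum_boole]

/-- the column-`0` cost is nonnegative. -/
theorem c0_nonneg (σ : Equiv.Perm (Fin (n + 1))) : 0 ≤ c0 n σ := by
  unfold c0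
  split_ifs with h
  · have := Q_pow_mono n (show 1 ≤ ((σ 0 : Fin (n + 1)) : ℕ) by omega)
    rw [pow_one] at this
    linarith
  · exact le_rfl

/-- **cost decomposition**: column `0` plus the anti-excedance columns (unit ascents and the diagonal are free,
long ascents off column `0` cost `0` by definition). -/
theorem cost_eq (σ : Equiv.Perm (Fin (n + 1))) :
    cost n σ = c0 n σ + ∑ i ∈ univ.filter (fun i : Fin (n + 1) => ((σ i : Fin (n + 1)) : ℕ) < (i : ℕ)),
      val n (σ i) i := by
  unfold cost
  rw [← Finset.sum_filter_add_sum_filter_not univ (fun i : Fin (n + 1) => ((σ i : Fin (n + 1)) : ℕ) < (i : ℕ)),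
    add_comm]
  congr 1
  have hc : ∀ i ∈ univ.filter (fun i : Fin (n + 1) => ¬ ((σ i : Fin (n + 1)) : ℕ) < (i : ℕ)),
      val n (σ i) i = if i = 0 then c0 n σ else 0 := by
    intro i hi
    rw [Finset.mem_filter] at hi
    obtain ⟨_, hi⟩ := hi
    by_cases hi0 : i = 0
    · subst hi0
      rw [if_pos rfl]
      unfold c0
      by_cases hs : 0 < ((σ 0 : Fin (n + 1)) : ℕ)
      · rw [if_pos hs, val_col0 n _ _ hs rfl]
      · rw [if_neg hs]
        have h0 : σ 0 = 0 := Fin.ext (by push Not at hs; exact Nat.le_zero.mp hs)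
        rw [h0, val_diag]
    · rw [if_neg hi0]
      have hi0' : (i : ℕ) ≠ 0 := fun h0 => hi0 (Fin.ext h0)
      rcases Nat.lt_or_ge (i : ℕ) ((σ i : Fin (n + 1)) : ℕ) with h | h
      · exact val_lower n _ _ h hi0'
      · have hs : σ i = i := Fin.ext (by omega)
        rw [hs, val_diag]
  rw [Finset.sum_congr rfl hc, Finset.sum_ite_eq']
  rw [if_pos]
  rw [Finset.mem_filter]
  exact ⟨Finset.mem_univ _, Nat.not_lt_zero _⟩

/-- a permutation whose entries are all on or above the diagonal (`σ b ≥ b`) is the identity. -/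
theorem perm_eq_one_of_forall_ge (σ : Equiv.Perm (Fin (n + 1))) (h : ∀ i : Fin (n + 1), (i : ℕ) ≤ ((σ i : Fin (n + 1)) : ℕ)) :
    σ = 1 := by
  have hsum : ∑ i : Fin (n + 1), (i : ℕ) = ∑ i : Fin (n + 1), ((σ i : Fin (n + 1)) : ℕ) :=
    (Equiv.sum_comp σ (fun i : Fin (n + 1) => (i : ℕ))).symm
  have hall := (Finset.sum_eq_sum_iff_of_le (fun i _ => h i)).mp hsum
  exact Equiv.ext fun i => (Fin.ext (hall i (Finset.mem_univ i))).symm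

/-- a permutation whose entries are all on or below the diagonal (`σ b ≤ b`) is the identity. -/
theorem perm_eq_one_of_forall_le (σ : Equiv.Perm (Fin (n + 1))) (h : ∀ i : Fin (n + 1), ((σ i : Fin (n + 1)) : ℕ) ≤ (i : ℕ)) :
    σ = 1 := by
  have hsum : ∑ i : Fin (n + 1), ((σ i : Fin (n + 1)) : ℕ) = ∑ i : Fin (n + 1), (i : ℕ) :=
    Equiv.sum_comp σ (fun i : Fin (n + 1) => (i : ℕ))
  have hall := (Finset.sum_eq_sum_iff_of_le (fun i _ => h i)).mp hsum
  exact Equiv.ext fun i => Fin.ext (hall i (Finset.mem_univ i))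

/-- no anti-excedance ⟹ identity. -/
theorem eq_one_of_aexc_eq_zero (σ : Equiv.Perm (Fin (n + 1))) (h : aexc n σ = 0) : σ = 1 := by
  unfold aexc at h
  rw [Finset.card_eq_zero, Finset.filter_eq_empty_iff] at h
  exact perm_eq_one_of_forall_ge n σ fun i => Nat.le_of_not_lt (h (Finset.mem_univ i))

/-- no excedance ⟹ identity. -/
theorem eq_one_of_exc_eq_zero (σ : Equiv.Perm (Fin (n + 1))) (h : exc n σ = 0) : σ = 1 := by
  unfold exc at h
  rw [Finset.card_eq_zero, Finset.filter_eq_empty_iff] at h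
  exact perm_eq_one_of_forall_le n σ fun i => Nat.le_of_not_lt (h (Finset.mem_univ i))

/-- the identity has no anti-excedance. -/
theorem aexc_one : aexc n 1 = 0 := by
  unfold aexc
  rw [Finset.card_eq_zero, Finset.filter_eq_empty_iff]
  intro i _
  simp

/-- the identity has no excedance. -/
theorem exc_one : exc n 1 = 0 := by
  unfold exc
  rw [Finset.card_eq_zero, Finset.filter_eq_empty_iff]
  intro i _
  simp

/-- an anti-excedance forces an excedance. -/
theorem one_le_exc (σ : Equiv.Perm (Fin (n + 1))) (h : 1 ≤ aexc n σ) : 1 ≤ exc n σ := by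
  by_contra hc
  have h0 : exc n σ = 0 := by omega
  have := eq_one_of_exc_eq_zero n σ h0
  rw [this, aexc_one] at h
  omega

/-- the two counts fit in `m`. -/
theorem exc_add_aexc_le (σ : Equiv.Perm (Fin (n + 1))) : exc n σ + aexc n σ ≤ n + 1 := by
  unfold exc aexc
  rw [← Finset.card_union_of_disjoint]
  · exact (Finset.card_le_univ _).trans (by simp)
  · rw [Finset.disjoint_filter]
    intro i _ h1 h2
    omega

/-- the identity has degree `0`. -/
theorem deg_one : deg n 1 = 0 := by
  rw [deg_eq, exc_one, aexc_one]; simp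

/-- the identity costs `0`. -/
theorem cost_one : cost n 1 = 0 := by
  unfold cost
  exact Finset.sum_eq_zero fun i _ => by rw [Equiv.Perm.coe_one, id_eq, val_diag]

/-- the mountain has `y` excedances. -/
theorem exc_mtn {y z : ℕ} (h : 1 ≤ y ∧ 1 ≤ z ∧ y + z ≤ n + 1) : exc n (mtn n y z) = y := by
  have h1 := deg_eq n (mtn n y z)
  rw [deg_mtn n h, aexc_mtn n h] at h1
  unfold Dg at h1
  have : (exc n (mtn n y z) : ℤ) = y := by linarith
  exact_mod_cast this

end Mountain

end Summit.ValiantsHypothesis.ValiantsHypothesis.Theorems.LacunarySymmetroidMatrixDescartes.TropicalCensus
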